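import Summits.CriticalPhenomena.PercolationContinuityZ3.Theorems.PercTorusSliceFillingSliceFillingUpperBound
import Literature.Probability.Percolation.MeanFieldBetaFromGamma

/-!
# `NoCriticalTorusGiant`, stub S1a: the chart bound for large non-slice-filling torus clusters
(route PercTorusSliceFilling, crux item stmt-CriticalPhenomena-5407, support file)

For Bernoulli bond percolation with ANY edge density `p`, every `n ≥ 3`, every vertex `x` of the
discrete torus `T_n = (ℤ/nℤ)³` (`torusGraph 3 n`) and every `k : ℕ`,

  `P_{T_n,p}(k ≤ |C(x)| ∧ C(x) is not slice-filling) ≤ P_{ℤ³,p}(|C(0)| ≥ k) − θ_{ℤ³}(p)`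
  (`= P_{ℤ³,p}(k ≤ |C(0)| < ∞)`),

where a torus cluster is SLICE-FILLING if in some direction `i` it meets every slice `{y_i = t}`.
At `k = 0` this is the landed `SliceFilling.theta_le_real_sliceFilling`
(`…Theorems/PercTorusSliceFillingSliceFillingUpperBound.lean`), and the proof is the same static
box-hull coupling with the hull event refined by `k ≤ |C|`; we prove it for every dimension `d`
(`S1a.real_large_nonSf_le`) and specialise to `d = 3` (`stub_nonSfLargeClusterChart`).

## Proof

Write `π z = x + (z mod n)` for the covering projection `ℤ^d → T_n` based at `x`, `E = E(ℤ^d)`,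
and `C_lift(0)` for the cluster of the origin in the periodic lift `{e ∈ E | Sym2.map π e ∈ ω}`.

1. PATH LIFTING (`S1a.openCluster_subset_image_lift`, the only new ingredient). If only torus
   edges are open (`ω ⊆ E(T_n)`, an almost sure event, `setBernoulli_ae_subset`), every open torus
   edge from `π u` goes to `π u ± e_i = π (u ± e_i)` and `s(u, u ± e_i)` is an open lattice edge
   of the lift, so `π '' C_lift(0)` is closed under open adjacency and contains `π 0 = x`:
   `C_T(x) ⊆ π '' C_lift(0)`, whence `|C_T(x)| ≤ |C_lift(0)|` as soon as `C_lift(0)` is finite.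
2. COVER. If `C_T(x)` misses a slice in every direction, `C_lift(0)` is confined to a box with at
   most `n - 1` points per side (`SliceFilling.confined`, `exists_hull_of_confined`, `mem_boxes`),
   so on the event `{k ≤ |C(x)| ∧ ¬ sf} ∩ {ω ⊆ E(T_n)}` some refined hull event
   `H_b = {s | hull of C_{s ∩ E}(0) is b ∧ k ≤ |C_{s ∩ E}(0)|}` contains the lift, hence (LOCALITY,
   `determinedBy_of_subset_box`) the local lift `{e ∈ W_b | Sym2.map π e ∈ ω}`.
3. TRANSFER. `P_T(L_b⁻¹ H_b) = P_ℤ(H_b)` (`SliceFilling.real_preimage_localLift`).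
4. The `H_b` are pairwise disjoint (`hull_unique`), measurable, and contained in
   `({|C(0)| ≥ k} \ {|C(0)| = ∞}) ∪ {s ⊄ E}` (a null set), so
   `∑_b P_ℤ(H_b) ≤ P_ℤ(|C(0)| ≥ k) − θ(p)` (`measureReal_sdiff`,
   `percolatesAt_subset_clusterSizeGe`).

References: Benjamini–Schramm 1996 Thm 1 / Heydenreich–van der Hofstad 2017 Prop. 13.7 (torus and
`ℤ^d` clusters agree until wrapping; static finite-range form); Grimmett 1999 §1.3–1.4.
Tree API: `theta`, `percolatesAt`, `clusterSizeGe`, `mem_clusterSizeGe`,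
`percolatesAt_subset_clusterSizeGe`, `measurableSet_percolatesAt_holds`, `setBernoulli_ae_subset`,
`determinedBy_iff`, `torusGraph_adj_iff`, `zdGraph_adj_iff`, and the `SliceFilling` chart files.
-/

noncomputable section

namespace Summit.CriticalPhenomena.PercolationContinuityZ3.Theorems.PercTorusSliceFillingNoCriticalTorusGiant

open MeasureTheory ProbabilityTheory unitInterval
open Literature.Probability.Percolation Literature.Probability.LatticeModels

namespace S1a

variable {d n : ℕ}

/-- **Path lifting.** If only torus edges are open, the torus cluster of `x` is contained in the
projection of the cluster of the origin in the periodic lift `{e ∈ E(ℤ^d) | Sym2.map π e ∈ ω}`: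
the image `π '' C_lift(0)` contains `π 0 = x` and is closed under open torus edges, since an open
edge from `π u` goes to `π u ± e_i = π (u ± e_i)` and `s(u, u ± e_i)` is then open in the lift. -/
theorem openCluster_subset_image_lift (x : TorusSite d n) (π : Site d → TorusSite d n)
    (hπ : ∀ z i, π z i = x i + ((z i : ℤ) : ZMod n)) {ω : Set (Sym2 (TorusSite d n))}
    (hω : ω ⊆ (torusGraph d n).edgeSet) :
    openCluster ω x ⊆ π '' openCluster {e ∈ (zdGraph d).edgeSet | Sym2.map π e ∈ ω} 0 := by
  intro v hv
  refine SliceFilling.mem_of_reachable_of_closed (G := openGraph ω)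
    (S := π '' openCluster {e ∈ (zdGraph d).edgeSet | Sym2.map π e ∈ ω} 0) ?_ hv
    ⟨0, mem_openCluster_self _ _, SliceFilling.proj_zero x π hπ⟩
  rintro _ w ⟨u, hu, rfl⟩ hadj
  rw [openGraph_adj] at hadj
  obtain ⟨hmem, -⟩ := hadj
  have hT : (torusGraph d n).Adj (π u) w := (SimpleGraph.mem_edgeSet _).1 (hω hmem)
  -- a lattice neighbour `u'` of `u` projecting to `w` lies in the lifted cluster
  have step : ∀ u' : Site d, (zdGraph d).Adj u u' → π u' = w →
      w ∈ π '' openCluster {e ∈ (zdGraph d).edgeSet | Sym2.map π e ∈ ω} 0 := by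
    rintro u' hadjZ rfl
    refine ⟨u', SimpleGraph.Reachable.trans hu (SimpleGraph.Adj.reachable ?_), rfl⟩
    rw [openGraph_adj]
    refine ⟨⟨(SimpleGraph.mem_edgeSet _).2 hadjZ, ?_⟩, hadjZ.ne⟩
    show Sym2.map π s(u, u') ∈ ω
    rw [Sym2.map_mk]
    exact hmem
  obtain ⟨-, ⟨i, hi⟩ | ⟨i, hi⟩⟩ := (torusGraph_adj_iff _ _).1 hT
  · exact step (u + Pi.single i 1) ((zdGraph_adj_iff _ _).2 ⟨i, Or.inl rfl⟩)
      (by rw [SliceFilling.proj_add_single x π hπ, hi])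
  · refine step (u - Pi.single i 1)
      ((zdGraph_adj_iff _ _).2 ⟨i, Or.inr (sub_add_cancel _ _).symm⟩) ?_
    have h := SliceFilling.proj_add_single x π hπ (u - Pi.single i 1) i
    rw [sub_add_cancel] at h
    exact add_right_cancel (h.symm.trans hi)

/-- **Chart bound, every dimension `d` and every `n ≥ 3`.** For every `x ∈ T_n` and every `k`,
`P_{T_n,p}(k ≤ |C(x)| ∧ C(x) not slice-filling) ≤ P_{ℤ^d,p}(|C(0)| ≥ k) − θ_{ℤ^d}(p)`. -/
theorem real_large_nonSf_le (hn : 3 ≤ n) (p : unitInterval) (x : TorusSite d n) (k : ℕ) :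
    (bondPercolation (torusGraph d n) p).real
        {ω | k ≤ (openCluster ω x).ncard ∧
          ¬ ∃ i : Fin d, ∀ t : ZMod n, ∃ y ∈ openCluster ω x, y i = t} ≤
      (bondPercolation (zdGraph d) p).real (clusterSizeGe (0 : Site d) k) -
        theta (zdGraph d) 0 p := by
  haveI : Fact (1 < n) := ⟨by omega⟩
  -- the projection based at `x`
  set π : Site d → TorusSite d n := fun z i => x i + ((z i : ℤ) : ZMod n)
  have hπ : ∀ z i, π z i = x i + ((z i : ℤ) : ZMod n) := fun z i => rfl
  set μZ := bondPercolation (zdGraph d) p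
  set μT := bondPercolation (torusGraph d n) p
  set A : Set (BondConfig (TorusSite d n)) :=
    {ω | k ≤ (openCluster ω x).ncard ∧
      ¬ ∃ i : Fin d, ∀ t : ZMod n, ∃ y ∈ openCluster ω x, y i = t}
  -- the refined hull predicate, the hull events `{s | P b (C_{s ∩ E}(0))}`, the boxes
  set P : Site d × Site d → Set (Site d) → Prop := fun b C =>
    (C ⊆ Set.Icc b.1 b.2 ∧ ∀ i, (∃ z ∈ C, z i = b.1 i) ∧ ∃ z ∈ C, z i = b.2 i) ∧ k ≤ C.ncard
  have hPsub : ∀ b C, P b C → C ⊆ Set.Icc b.1 b.2 := fun b C h => h.1.1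
  set boxes : Finset (Site d × Site d) :=
    (Finset.Icc (fun _ : Fin d => 2 - (n : ℤ)) 0 ×ˢ
      Finset.Icc 0 (fun _ : Fin d => (n : ℤ) - 2)).filter
        (fun b => ∀ i, b.2 i - b.1 i ≤ (n : ℤ) - 2)
  -- Step 1: the null events "a non-edge is open", downstairs and upstairs
  have hnullT : μT.real {ω : BondConfig (TorusSite d n) | ¬ ω ⊆ (torusGraph d n).edgeSet} = 0 := by
    have h := setBernoulli_ae_subset (u := (torusGraph d n).edgeSet) (p := p)
    rw [measureReal_eq_zero_iff]
    exact ae_iff.1 h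
  have hnull : μZ.real {s : BondConfig (Site d) | ¬ s ⊆ (zdGraph d).edgeSet} = 0 := by
    have h := setBernoulli_ae_subset (u := (zdGraph d).edgeSet) (p := p)
    rw [measureReal_eq_zero_iff]
    exact ae_iff.1 h
  -- Step 2: cover of `A ∩ {ω ⊆ E(T_n)}` by the pulled-back refined hull events
  have hcover : A ∩ {ω | ω ⊆ (torusGraph d n).edgeSet} ⊆ ⋃ b ∈ boxes,
      (fun t => {e | e ∈ {e ∈ (zdGraph d).edgeSet | ∃ z ∈ Set.Icc b.1 b.2, z ∈ e} ∧
        Sym2.map π e ∈ t}) ⁻¹' {s | P b (openCluster (s ∩ (zdGraph d).edgeSet) 0)} := by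
    rintro ω ⟨⟨hk, hω⟩, hωE⟩
    have hω' : ∀ i : Fin d, ∃ t : ZMod n, ∀ y ∈ openCluster ω x, y i ≠ t := by
      intro i
      by_contra h
      push Not at h
      exact hω ⟨i, h⟩
    obtain ⟨r, hr, hconf⟩ := SliceFilling.confined hn x π hπ ω hω'
    obtain ⟨b, hb1, hb2, hb3⟩ :=
      SliceFilling.exists_hull_of_confined (n := n) (mem_openCluster_self _ _) hr hconf
    have hfin : (openCluster {e ∈ (zdGraph d).edgeSet | Sym2.map π e ∈ ω} 0).Finite :=
      (Set.finite_Icc _ _).subset hb3.1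
    have hkl : k ≤ (openCluster {e ∈ (zdGraph d).edgeSet | Sym2.map π e ∈ ω} 0).ncard :=
      hk.trans ((Set.ncard_le_ncard (openCluster_subset_image_lift x π hπ hωE)
        (hfin.image π)).trans (Set.ncard_image_le hfin))
    refine Set.mem_biUnion (SliceFilling.mem_boxes hb1 hb2) ?_
    rw [Set.mem_preimage]
    have hlift : {e ∈ (zdGraph d).edgeSet | Sym2.map π e ∈ ω} ∈
        {s | P b (openCluster (s ∩ (zdGraph d).edgeSet) 0)} := by
      rw [Set.mem_setOf_eq, Set.inter_eq_left.2 (Set.sep_subset _ _)]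
      exact ⟨hb3, hkl⟩
    refine ((determinedBy_iff _ _).1
      (SliceFilling.determinedBy_of_subset_box b (hPsub b)) _ _ ?_).1 hlift
    ext e
    simp only [Set.mem_inter_iff, Set.mem_setOf_eq]
    tauto
  -- Step 3/4: disjointness, measurability, containment
  have hdisj : Set.PairwiseDisjoint (↑boxes : Set (Site d × Site d))
      (fun b => {s : Set (Sym2 (Site d)) | P b (openCluster (s ∩ (zdGraph d).edgeSet) 0)}) := by
    intro b _ b' _ hbb'
    rw [Function.onFun, Set.disjoint_left]
    intro s hs hs'
    exact hbb' (SliceFilling.hull_unique hs.1 hs'.1)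
  have hmeas : ∀ b ∈ boxes,
      MeasurableSet {s : Set (Sym2 (Site d)) | P b (openCluster (s ∩ (zdGraph d).edgeSet) 0)} :=
    fun b _ => SliceFilling.measurableSet_of_determinedBy_window b
      (SliceFilling.determinedBy_of_subset_box b (hPsub b))
  have hsub :
      (⋃ b ∈ boxes, {s : Set (Sym2 (Site d)) | P b (openCluster (s ∩ (zdGraph d).edgeSet) 0)}) ⊆
        (clusterSizeGe (0 : Site d) k \ percolatesAt 0) ∪ {s | ¬ s ⊆ (zdGraph d).edgeSet} := by
    intro s hs
    rw [Set.mem_iUnion₂] at hs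
    obtain ⟨b, -, hsb⟩ := hs
    by_cases hsE : s ⊆ (zdGraph d).edgeSet
    · left
      have hsb' : P b (openCluster (s ∩ (zdGraph d).edgeSet) 0) := hsb
      rw [Set.inter_eq_left.2 hsE] at hsb'
      have hfin : (openCluster s 0).Finite := (Set.finite_Icc _ _).subset hsb'.1.1
      refine ⟨?_, fun hinf => hinf hfin⟩
      rw [mem_clusterSizeGe, ← hfin.cast_ncard_eq]
      exact_mod_cast hsb'.2
    · right; exact hsE
  have hperc : MeasurableSet (percolatesAt (0 : Site d) : Set (BondConfig (Site d))) :=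
    measurableSet_percolatesAt_holds 0
  have hθ : theta (zdGraph d) 0 p = μZ.real (percolatesAt 0) := rfl
  calc μT.real A
      ≤ μT.real (A ∩ {ω | ω ⊆ (torusGraph d n).edgeSet} ∪
          {ω | ¬ ω ⊆ (torusGraph d n).edgeSet}) :=
        measureReal_mono (fun ω hω => by
          by_cases h : ω ⊆ (torusGraph d n).edgeSet
          · exact Or.inl ⟨hω, h⟩
          · exact Or.inr h) (measure_ne_top _ _)
    _ ≤ μT.real (A ∩ {ω | ω ⊆ (torusGraph d n).edgeSet}) +
          μT.real {ω | ¬ ω ⊆ (torusGraph d n).edgeSet} :=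
        measureReal_union_le _ _
    _ = μT.real (A ∩ {ω | ω ⊆ (torusGraph d n).edgeSet}) := by rw [hnullT, add_zero]
    _ ≤ μT.real (⋃ b ∈ boxes,
          (fun t => {e | e ∈ {e ∈ (zdGraph d).edgeSet | ∃ z ∈ Set.Icc b.1 b.2, z ∈ e} ∧
            Sym2.map π e ∈ t}) ⁻¹' {s | P b (openCluster (s ∩ (zdGraph d).edgeSet) 0)}) :=
        measureReal_mono hcover (measure_ne_top _ _)
    _ ≤ ∑ b ∈ boxes, μT.real
          ((fun t => {e | e ∈ {e ∈ (zdGraph d).edgeSet | ∃ z ∈ Set.Icc b.1 b.2, z ∈ e} ∧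
            Sym2.map π e ∈ t}) ⁻¹' {s | P b (openCluster (s ∩ (zdGraph d).edgeSet) 0)}) :=
        measureReal_biUnion_finset_le _ _
    _ = ∑ b ∈ boxes, μZ.real {s | P b (openCluster (s ∩ (zdGraph d).edgeSet) 0)} :=
        Finset.sum_congr rfl fun b hb => SliceFilling.real_preimage_localLift hn x π hπ p
          (Finset.mem_filter.1 hb).2 (SliceFilling.determinedBy_of_subset_box b (hPsub b))
    _ = μZ.real (⋃ b ∈ boxes, {s | P b (openCluster (s ∩ (zdGraph d).edgeSet) 0)}) :=
        (measureReal_biUnion_finset hdisj hmeas).symm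
    _ ≤ μZ.real ((clusterSizeGe (0 : Site d) k \ percolatesAt 0) ∪
          {s | ¬ s ⊆ (zdGraph d).edgeSet}) :=
        measureReal_mono hsub (measure_ne_top _ _)
    _ ≤ μZ.real (clusterSizeGe (0 : Site d) k \ percolatesAt 0) +
          μZ.real {s | ¬ s ⊆ (zdGraph d).edgeSet} :=
        measureReal_union_le _ _
    _ = μZ.real (clusterSizeGe (0 : Site d) k \ percolatesAt 0) := by rw [hnull, add_zero]
    _ = μZ.real (clusterSizeGe (0 : Site d) k) - theta (zdGraph d) 0 p := by
        rw [hθ, measureReal_sdiff (percolatesAt_subset_clusterSizeGe 0 k) hperc]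

end S1a

/-- **Stub S1a — chart bound for large non-slice-filling clusters, at every `p`.**  For `n ≥ 3`,
every vertex `x` of `T_n = (ℤ/nℤ)³` and every `k`,
`P_{T_n,p}(k ≤ |C(x)| ∧ C(x) not slice-filling) ≤ P_{ℤ³,p}(|C(0)| ≥ k) − θ_{ℤ³}(p)`
(the `d = 3` case of `S1a.real_large_nonSf_le`). -/
theorem stub_nonSfLargeClusterChart :
    ∀ (p : unitInterval) (n : ℕ), 3 ≤ n → ∀ (x : TorusSite 3 n) (k : ℕ),
      (bondPercolation (torusGraph 3 n) p).real
          {ω | k ≤ (openCluster ω x).ncard ∧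
            ¬ ∃ i : Fin 3, ∀ t : ZMod n, ∃ y ∈ openCluster ω x, y i = t} ≤
        (bondPercolation (zdGraph 3) p).real (clusterSizeGe (0 : Site 3) k) -
          theta (zdGraph 3) 0 p :=
  fun p _ hn x k => S1a.real_large_nonSf_le hn p x k

end Summit.CriticalPhenomena.PercolationContinuityZ3.Theorems.PercTorusSliceFillingNoCriticalTorusGiant
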